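import Summits.QuantumFields.YangMills.Theorems.ColdStartUniversalityLatticeLangevinMarkovProperty
import HarnessLib

/-!
# Route `ColdStartUniversality` (fixed-cut-off SZZ dynamics, sampler package): THE MARTINGALE INCREMENTS OF THE `h`-SKELETON CHAIN —
# `D_k = u(U_((k+1)h)) − (κ_h u)(U_(kh))` are adapted, bounded, ORTHOGONAL TO THE PAST, with EXACT predictable variance `v(U_(kh))`

Helper file (seat `ym-line-csu-p1`, g35; `--supports stmt-QuantumFields-24809`).  For the SU(2) lattice Langevin (Shen–Zhu–Zhu) dynamics at any
coupling, a realising Markov kernel family `κ`, ANY bounded measurable `u` (`|u| ≤ b`), every strong solution `U` from a deterministic start on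
ANY probability space and every step `h`, the increments `D_k = u(U_((k+1)h)) − ∫ u dκ_h(U_(kh))` and the proxies
`v_k = (∫ u² dκ_h − (∫ u dκ_h)²)(U_(kh))` satisfy (★★ `exists_discreteIncrements`):
* `D_k` is `𝓕^W_((k+1)h)`-measurable, `v_k` is `𝓕^W_(kh)`-measurable, `|D_k| ≤ 2b`, `0 ≤ v_k ≤ b²`-type bounds are inherited from `u`;
* ORTHOGONALITY `E[Z · D_k] = 0` and the EXACT CONDITIONAL VARIANCE `E[Z · (D_k² − v_k)] = 0` for every bounded non-negative
  `𝓕^W_(kh)`-measurable weight `Z` — two applications of the Markov property of file 44 (`integral_mul_comp_add_eq_integral_mul_transition`,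
  weights `Z` and `Z·(κ_h u)(U_(kh))`).
These are exactly the hypotheses of the martingale-CLT engine (files 92a–c) with `η = 0`.  THEOREMS ONLY, no definition, no sorry; [folklore].
HONEST FRAMING: fixed cut-off; `UniformColdStartMixing` (24809) is NOT restated; no crux, rung or summit statement is proved; the Yang–Mills mass
gap is NOT proved.
-/

set_option autoImplicit false

noncomputable section

namespace Summit.QuantumFields.YangMills.Theorems.ColdStartUniversality

open MeasureTheory ProbabilityTheory Filter Topology Set
open scoped NNReal ENNReal BigOperators
open Literature Literature.Probability.Process Literature.MathematicalPhysics.QuantumFieldTheory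
open Literature.MathematicalPhysics.QuantumLattice (fundamentalRep fundamentalLatticeRep continuous_fundamentalRep)

variable {L : ℕ} [NeZero L]

/-- ★★ **Martingale increments of the `h`-skeleton chain with exact predictable variance.**  See the module docstring. [folklore] -/
theorem exists_discreteIncrements (β' : ℝ)
    (κ : ℝ≥0 → Kernel (GaugeConfig 3 L (Matrix.specialUnitaryGroup (Fin 2) ℂ))
      (GaugeConfig 3 L (Matrix.specialUnitaryGroup (Fin 2) ℂ))) [∀ t, IsMarkovKernel (κ t)]
    (hreal : ∀ (t : ℝ≥0) (x : GaugeConfig 3 L (Matrix.specialUnitaryGroup (Fin 2) ℂ))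
        (Ω : Type) [MeasurableSpace Ω] (P : Measure Ω) [IsProbabilityMeasure P]
        (W : ℝ≥0 → Ω → (Edge 3 L × NoiseIdx 2 → ℝ)) (hW : IsFlatBrownian W P)
        (U : ℝ≥0 → Ω → GaugeConfig 3 L (Matrix.specialUnitaryGroup (Fin 2) ℂ)),
        (∀ ω, U 0 ω = x) →
        (latticeLangevinDynamics (fundamentalLatticeRep 2) β').IsSolution (fundamentalRep (Fin 2))
          hW.natFiltration P W U →
        κ t x = P.map (U t))
    {u : GaugeConfig 3 L (Matrix.specialUnitaryGroup (Fin 2) ℂ) → ℝ} (hum : Measurable u) {b : ℝ} (hub : ∀ y, |u y| ≤ b)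
    (x : GaugeConfig 3 L (Matrix.specialUnitaryGroup (Fin 2) ℂ))
    {Ω : Type} [MeasurableSpace Ω] {P : Measure Ω} [IsProbabilityMeasure P]
    {W : ℝ≥0 → Ω → (Edge 3 L × NoiseIdx 2 → ℝ)} (hW : IsFlatBrownian W P)
    {U : ℝ≥0 → Ω → GaugeConfig 3 L (Matrix.specialUnitaryGroup (Fin 2) ℂ)} (hU0 : ∀ ω, U 0 ω = x)
    (hU : (latticeLangevinDynamics (fundamentalLatticeRep 2) β').IsSolution (fundamentalRep (Fin 2)) hW.natFiltration P W U)
    (h : ℝ≥0) :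
    ∃ D v : ℕ → Ω → ℝ,
      (∀ k ω, D k ω = u (U (((k + 1 : ℕ) : ℝ≥0) * h) ω) - ∫ z, u z ∂(κ h (U ((k : ℝ≥0) * h) ω))) ∧
      (∀ k ω, v k ω = (∫ z, u z ^ 2 ∂(κ h (U ((k : ℝ≥0) * h) ω))) - (∫ z, u z ∂(κ h (U ((k : ℝ≥0) * h) ω))) ^ 2) ∧
      (∀ k, Measurable[hW.natFiltration (((k + 1 : ℕ) : ℝ≥0) * h)] (D k)) ∧
      (∀ k : ℕ, Measurable[hW.natFiltration ((k : ℝ≥0) * h)] (v k)) ∧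
      (∀ k ω, |D k ω| ≤ 2 * b) ∧
      (∀ (k : ℕ) (Z : Ω → ℝ), Measurable[hW.natFiltration ((k : ℝ≥0) * h)] Z → (∀ ω, 0 ≤ Z ω) → (∃ CZ : ℝ, ∀ ω, Z ω ≤ CZ) →
        ∫ ω, Z ω * D k ω ∂P = 0) ∧
      (∀ (k : ℕ) (Z : Ω → ℝ), Measurable[hW.natFiltration ((k : ℝ≥0) * h)] Z → (∀ ω, 0 ≤ Z ω) → (∃ CZ : ℝ, ∀ ω, Z ω ≤ CZ) →
        ∫ ω, Z ω * (D k ω ^ 2 - v k ω) ∂P = 0) := by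
  classical
  have hb0 : 0 ≤ b := (abs_nonneg _).trans (hub x)
  have hmU : ∀ s : ℝ≥0, Measurable (U s) := fun s => (hU.adapted s).mono (hW.natFiltration.le s) le_rfl
  -- the kernel actions `κ_h u`, `κ_h u²`
  set cu : GaugeConfig 3 L (Matrix.specialUnitaryGroup (Fin 2) ℂ) → ℝ := fun y => ∫ z, u z ∂(κ h y) with hcu
  set qu : GaugeConfig 3 L (Matrix.specialUnitaryGroup (Fin 2) ℂ) → ℝ := fun y => ∫ z, u z ^ 2 ∂(κ h y) with hqu
  have hcum : Measurable cu := (hum.stronglyMeasurable.integral_kernel (κ := κ h)).measurable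
  have hqum : Measurable qu := ((hum.pow_const 2).stronglyMeasurable.integral_kernel (κ := κ h)).measurable
  have hu2b : ∀ z, |u z ^ 2| ≤ b ^ 2 := fun z => by
    rw [abs_of_nonneg (sq_nonneg _), ← sq_abs]; exact pow_le_pow_left₀ (abs_nonneg _) (hub z) 2
  have hcub : ∀ y, |cu y| ≤ b := fun y => by
    have hh' := norm_integral_le_of_norm_le_const (μ := κ h y) (f := u) (C := b)
      (Eventually.of_forall fun z => by simpa [Real.norm_eq_abs] using hub z)
    simpa [Real.norm_eq_abs] using hh'
  have hqub : ∀ y, |qu y| ≤ b ^ 2 := fun y => by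
    have hh' := norm_integral_le_of_norm_le_const (μ := κ h y) (f := fun z => u z ^ 2) (C := b ^ 2)
      (Eventually.of_forall fun z => by simpa [Real.norm_eq_abs] using hu2b z)
    simpa [Real.norm_eq_abs] using hh'
  set D : ℕ → Ω → ℝ := fun k ω => u (U (((k + 1 : ℕ) : ℝ≥0) * h) ω) - cu (U ((k : ℝ≥0) * h) ω) with hD
  set v : ℕ → Ω → ℝ := fun k ω => qu (U ((k : ℝ≥0) * h) ω) - cu (U ((k : ℝ≥0) * h) ω) ^ 2 with hv
  have hkh : ∀ k : ℕ, (k : ℝ≥0) * h ≤ (((k + 1 : ℕ) : ℝ≥0) * h) := fun k =>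
    mul_le_mul_of_nonneg_right (by exact_mod_cast Nat.le_succ k) h.2
  have hDF : ∀ k, Measurable[hW.natFiltration (((k + 1 : ℕ) : ℝ≥0) * h)] (D k) := fun k =>
    (hum.comp (hU.adapted _)).sub ((hcum.comp (hU.adapted _)).mono (hW.natFiltration.mono (hkh k)) le_rfl)
  have hvF : ∀ k : ℕ, Measurable[hW.natFiltration ((k : ℝ≥0) * h)] (v k) := fun k =>
    (hqum.comp (hU.adapted _)).sub ((hcum.comp (hU.adapted _)).pow_const 2)
  have hDb : ∀ k ω, |D k ω| ≤ 2 * b := fun k ω => by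
    simp only [hD]
    exact (abs_sub _ _).trans (by linarith [hub (U (((k + 1 : ℕ) : ℝ≥0) * h) ω), hcub (U ((k : ℝ≥0) * h) ω)])
  have ht : ∀ k : ℕ, (((k + 1 : ℕ) : ℝ≥0) * h) = (k : ℝ≥0) * h + h := fun k => by push_cast; ring
  -- integrability of bounded measurable products
  have hInt : ∀ {φ ψ : Ω → ℝ} {Cφ Cψ : ℝ}, Measurable φ → Measurable ψ → (∀ ω, |φ ω| ≤ Cφ) → (∀ ω, |ψ ω| ≤ Cψ) →
      Integrable (fun ω => φ ω * ψ ω) P := fun hφ hψ hφb hψb =>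
    (integrable_const _).mono' (hφ.mul hψ).aestronglyMeasurable (Eventually.of_forall fun ω => by
      rw [norm_mul, Real.norm_eq_abs, Real.norm_eq_abs]
      exact mul_le_mul (hφb ω) (hψb ω) (abs_nonneg _) ((abs_nonneg _).trans (hφb ω)))
  refine ⟨D, v, fun k ω => rfl, fun k ω => rfl, hDF, hvF, hDb, fun k Z hZF hZ0 hZb => ?_, fun k Z hZF hZ0 hZb => ?_⟩
  · -- orthogonality
    obtain ⟨CZ, hCZ⟩ := hZb
    have hZabs : ∀ ω, |Z ω| ≤ CZ := fun ω => by rw [abs_of_nonneg (hZ0 ω)]; exact hCZ ω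
    have hZm : Measurable Z := hZF.mono (hW.natFiltration.le _) le_rfl
    have e1 : ∫ ω, Z ω * u (U (((k + 1 : ℕ) : ℝ≥0) * h) ω) ∂P = ∫ ω, Z ω * cu (U ((k : ℝ≥0) * h) ω) ∂P := by
      rw [ht]
      exact integral_mul_comp_add_eq_integral_mul_transition β' κ hreal x hW hU0 hU ((k : ℝ≥0) * h) h hZF hZabs hum hub
    have i1 : Integrable (fun ω => Z ω * u (U (((k + 1 : ℕ) : ℝ≥0) * h) ω)) P := hInt hZm (hum.comp (hmU _)) hZabs fun ω => hub _
    have i2 : Integrable (fun ω => Z ω * cu (U ((k : ℝ≥0) * h) ω)) P := hInt hZm (hcum.comp (hmU _)) hZabs fun ω => hcub _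
    have hpt : ∀ ω, Z ω * D k ω = Z ω * u (U (((k + 1 : ℕ) : ℝ≥0) * h) ω) - Z ω * cu (U ((k : ℝ≥0) * h) ω) := fun ω => by
      simp only [hD]; ring
    rw [integral_congr_ae (ae_of_all _ hpt), integral_sub i1 i2, e1, sub_self]
  · -- exact conditional variance
    obtain ⟨CZ, hCZ⟩ := hZb
    have hZabs : ∀ ω, |Z ω| ≤ CZ := fun ω => by rw [abs_of_nonneg (hZ0 ω)]; exact hCZ ω
    have hZm : Measurable Z := hZF.mono (hW.natFiltration.le _) le_rfl
    have hC0 : 0 ≤ CZ := (hZ0 (Classical.choice (nonempty_of_isProbabilityMeasure P))).trans (hCZ _)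
    -- the weight `Z · (κ_h u)(U_(kh))`
    set Zc : Ω → ℝ := fun ω => Z ω * cu (U ((k : ℝ≥0) * h) ω) with hZc
    have hZcF : Measurable[hW.natFiltration ((k : ℝ≥0) * h)] Zc := hZF.mul (hcum.comp (hU.adapted _))
    have hZcb : ∀ ω, |Zc ω| ≤ CZ * b := fun ω => by
      simp only [hZc, abs_mul]; exact mul_le_mul (hZabs ω) (hcub _) (abs_nonneg _) hC0
    have hZcm : Measurable Zc := hZcF.mono (hW.natFiltration.le _) le_rfl
    -- Markov property twice
    have e1 : ∫ ω, Z ω * (u (U (((k + 1 : ℕ) : ℝ≥0) * h) ω)) ^ 2 ∂P = ∫ ω, Z ω * qu (U ((k : ℝ≥0) * h) ω) ∂P := by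
      rw [ht]
      exact integral_mul_comp_add_eq_integral_mul_transition β' κ hreal x hW hU0 hU ((k : ℝ≥0) * h) h hZF hZabs
        (hum.pow_const 2) hu2b
    have e2 : ∫ ω, Zc ω * u (U (((k + 1 : ℕ) : ℝ≥0) * h) ω) ∂P = ∫ ω, Zc ω * cu (U ((k : ℝ≥0) * h) ω) ∂P := by
      rw [ht]
      exact integral_mul_comp_add_eq_integral_mul_transition β' κ hreal x hW hU0 hU ((k : ℝ≥0) * h) h hZcF hZcb hum hub
    have i1 : Integrable (fun ω => Z ω * (u (U (((k + 1 : ℕ) : ℝ≥0) * h) ω)) ^ 2) P :=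
      hInt hZm ((hum.comp (hmU _)).pow_const 2) hZabs fun ω => hu2b _
    have i2 : Integrable (fun ω => Z ω * qu (U ((k : ℝ≥0) * h) ω)) P := hInt hZm (hqum.comp (hmU _)) hZabs fun ω => hqub _
    have i3 : Integrable (fun ω => Zc ω * u (U (((k + 1 : ℕ) : ℝ≥0) * h) ω)) P := hInt hZcm (hum.comp (hmU _)) hZcb fun ω => hub _
    have i4 : Integrable (fun ω => Zc ω * cu (U ((k : ℝ≥0) * h) ω)) P := hInt hZcm (hcum.comp (hmU _)) hZcb fun ω => hcub _
    have hpt : ∀ ω, Z ω * (D k ω ^ 2 - v k ω) =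
        (Z ω * (u (U (((k + 1 : ℕ) : ℝ≥0) * h) ω)) ^ 2 - Z ω * qu (U ((k : ℝ≥0) * h) ω)) -
          2 * (Zc ω * u (U (((k + 1 : ℕ) : ℝ≥0) * h) ω) - Zc ω * cu (U ((k : ℝ≥0) * h) ω)) := fun ω => by
      simp only [hD, hv, hZc]; ring
    have i12 : Integrable (fun ω => Z ω * (u (U (((k + 1 : ℕ) : ℝ≥0) * h) ω)) ^ 2 - Z ω * qu (U ((k : ℝ≥0) * h) ω)) P := i1.sub i2
    have i34 : Integrable (fun ω => Zc ω * u (U (((k + 1 : ℕ) : ℝ≥0) * h) ω) - Zc ω * cu (U ((k : ℝ≥0) * h) ω)) P := i3.sub i4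
    have i34' : Integrable (fun ω => 2 * (Zc ω * u (U (((k + 1 : ℕ) : ℝ≥0) * h) ω) - Zc ω * cu (U ((k : ℝ≥0) * h) ω))) P :=
      i34.const_mul 2
    rw [integral_congr_ae (ae_of_all _ hpt), integral_sub i12 i34', integral_const_mul,
      integral_sub i1 i2, integral_sub i3 i4, e1, e2, sub_self, sub_self, mul_zero, sub_zero]

end Summit.QuantumFields.YangMills.Theorems.ColdStartUniversality

end
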